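import Summits.HubbardSuperconductivity.HubbardSuperconductivity.Theses.ThermalWedge
import Summits.HubbardSuperconductivity.HubbardSuperconductivity.Theorems.ThermalWedgeTwSeededEnsembleEquivalenceRColdSlice
import Summits.HubbardSuperconductivity.HubbardSuperconductivity.Theorems.ThermalWedgeTwSeededEnsembleEquivalenceRColdAssembly
import Summits.HubbardSuperconductivity.HubbardSuperconductivity.Theorems.ThermalWedgeTwSeededEnsembleEquivalenceRDanskinEnvelope
import Summits.HubbardSuperconductivity.HubbardSuperconductivity.Theorems.ThermalWedgeTwSeededEnsembleEquivalenceRColdDiffUniqSmall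
import Summits.HubbardSuperconductivity.HubbardSuperconductivity.Theorems.ThermalWedgeTwSeededEnsembleEquivalenceRColdEdgeGlue
import Summits.HubbardSuperconductivity.HubbardSuperconductivity.Theorems.ThermalWedgeTwSeededEnsembleEquivalenceRFreePairEnergyBandBottom
import Summits.HubbardSuperconductivity.HubbardSuperconductivity.Theorems.ThermalWedgeTwSeededEnsembleEquivalenceRFreeDensityBandBottom
import Summits.HubbardSuperconductivity.HubbardSuperconductivity.Theorems.ThermalWedgeTwSeededEnsembleEquivalenceRFreeDensityNearHalfFilling
import Summits.HubbardSuperconductivity.HubbardSuperconductivity.Theorems.ThermalWedgeTwSeededEnsembleEquivalenceRSourcedPressureLimit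

/-!
# Crux `TwSeededEnsembleEquivalenceR` (stmt-HubbardSuperconductivity-15581) FROM ITS TWO PHYSICS INPUTS:
# the line `cold-floor-collapse` (slug `Sketch`) closed modulo DIFF and UNIQ

Support file (`--supports stmt-HubbardSuperconductivity-15581`; sorry-free; no definition). This is the
sorry-free form of the line's skeleton v5 (`Cruxes/TwSeededEnsembleEquivalenceR/Lines/Sketch.lean`): every
infrastructure and free-gas stub of the line has LANDED —

* S1 `stub_danskinEnvelope` (…RDanskinEnvelope), S5 `stub_coldAssembly` (…RColdAssembly), the cold slice
  `twR_of_coldDifferentiablePressure` (…RColdSlice), the S4a glue `sourcedColdDiffUniq_of_diff_uniqSmall`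
  (…RColdDiffUniqSmall),
* S3 `stub_sourcedPressureLimit` — thermodynamic limit of the sourced torus pressure (…RSourcedPressureLimit,
  route seat 0),
* G″ `sourcedColdRegularity_of_freeFacts` (…RColdEdgeGlue) with the three analytic free-BdG facts
  F1 `stub_freePairEnergyBandBottom`, F2 `stub_freeDensityBandBottom`, F3 `stub_freeDensityNearHalfFilling`,

so the route decl `ThermalWedge.TwSeededEnsembleEquivalenceR` (the thermal-window canonical/grand-canonical
defect bound of the d-wave-seeded weakly repulsive Hubbard torus) follows, kernel-checked, from EXACTLY the two
physics statements the route's why-might-fail names, taken here as hypotheses with their registered stub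
signatures verbatim:

* DIFF (`stub_sourcedColdDiff`): on every compact window `[μ₁,μ₂] ⊂ (−4,0)` there is `a₀ > 0` such that for
  all `a ∈ (0,a₀]` (with a seed floor `K′` and `U ≤ U₀`) the infinite-volume SOURCED pressure at `β = e^{a/U}`
  is differentiable in `μ` on `(μ₁,μ₂)` at every fixed source `|h| ≤ 13g+1` — the sourced convergent expansion
  one `μ`-derivative deep at fillings 0.6–0.9 (Benfatto–Giuliani–Mastropietro 2006 class; not in print with a
  Nambu source);
* UNIQ′ (`stub_sourcedColdUniq`, v5: small exponents only): there is `a₁ > 0` such that for all `a ∈ (0,a₁]`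
  (seed floor `K′(a)`, `U ≤ U₀(a)`) the optimal source modulus of `h ↦ q(μ,h) − h²/g` on `|h| ≤ 13g+1` is unique
  (`argmax ⊆ {h*, −h*}`) — strict `s = h²`-concavity of the cold sourced pressure, the BCS-variational content
  (true and elementary at `U = 0`); same quantifier shape as DIFF, common exponent `a := min a₀ a₁`.

`twR_of_coldDiff_coldUniq : DIFF → UNIQ′ → TwSeededEnsembleEquivalenceR`. A planner promoting the physics to
items can cite this theorem as the glue; the conjunction DIFF ∧ UNIQ may equivalently be replaced by the single
weaker input "the cold SEEDED limit pressure `μ ↦ sup_h [q(μ,h) − h²/g]` is differentiable on the window" through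
`twR_of_coldDifferentiablePressure` + `stub_coldAssembly`'s TDL part. [folklore composition]
-/

set_option linter.dupNamespace false

namespace Summit.HubbardSuperconductivity.HubbardSuperconductivity.Theorems.TwSeededEnsembleEquivalenceR.ColdFloorLine

open Matrix Filter Topology Finset Literature.MathematicalPhysics.QuantumLattice
open Summit.HubbardSuperconductivity.HubbardSuperconductivity.Theses.ThermalWedge
open Summit.HubbardSuperconductivity.HubbardSuperconductivity.Theorems.TwSeededEnsembleEquivalenceR.ColdFloor
open scoped ComplexOrder
open Real MeasureTheory intervalIntegral

noncomputable section

/-- **The crux `TwSeededEnsembleEquivalenceR` from DIFF and UNIQ** (line `cold-floor-collapse`, all other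
stubs landed): cold slice ∘ S5(S3, S1, G″(S3, glue(DIFF, UNIQ′), F1, F2, F3)). [folklore composition] -/
theorem twR_of_coldDiff_coldUniq :
    (∀ (μ₁ μ₂ : ℝ), -4 < μ₁ → μ₁ < μ₂ → μ₂ < 0 → ∃ a₀ : ℝ, 0 < a₀ ∧ ∀ a ∈ Set.Ioc (0 : ℝ) a₀,
      ∃ K' U₀ : ℝ, 0 < K' ∧ 0 < U₀ ∧ ∀ U ∈ Set.Ioc (0 : ℝ) U₀, ∀ g ∈ Set.Icc (K' * U) (1 / 10),
        ∀ q : ℝ → ℝ → ℝ,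
          (∀ μ ∈ Set.Icc μ₁ μ₂, ∀ h ∈ Set.Icc (-(13 * g + 1)) (13 * g + 1), ∀ κ : ℝ, 0 < κ →
            ∃ L₀ : ℕ, ∀ (L : ℕ) [NeZero L], L₀ ≤ L →
              |Real.log (Matrix.partitionFn (Real.exp (a / U)) (dWaveSourceTorus L U μ h)).re /
                  (Real.exp (a / U) * (L : ℝ) ^ 2) - q μ h| ≤ κ) →
          ∀ μ ∈ Set.Ioo μ₁ μ₂, ∀ h ∈ Set.Icc (-(13 * g + 1)) (13 * g + 1),
            DifferentiableAt ℝ (fun μ' => q μ' h) μ) →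
    (∀ (μ₁ μ₂ : ℝ), -4 < μ₁ → μ₁ < μ₂ → μ₂ < 0 → ∃ a₁ : ℝ, 0 < a₁ ∧ ∀ a ∈ Set.Ioc (0 : ℝ) a₁,
      ∃ K' U₀ : ℝ, 0 < K' ∧ 0 < U₀ ∧ ∀ U ∈ Set.Ioc (0 : ℝ) U₀, ∀ g ∈ Set.Icc (K' * U) (1 / 10),
        ∀ q : ℝ → ℝ → ℝ,
          (∀ μ ∈ Set.Icc μ₁ μ₂, ∀ h ∈ Set.Icc (-(13 * g + 1)) (13 * g + 1), ∀ κ : ℝ, 0 < κ →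
            ∃ L₀ : ℕ, ∀ (L : ℕ) [NeZero L], L₀ ≤ L →
              |Real.log (Matrix.partitionFn (Real.exp (a / U)) (dWaveSourceTorus L U μ h)).re /
                  (Real.exp (a / U) * (L : ℝ) ^ 2) - q μ h| ≤ κ) →
          ∀ μ ∈ Set.Ioo μ₁ μ₂, ∃ hstar : ℝ, ∀ h ∈ Set.Icc (-(13 * g + 1)) (13 * g + 1),
            q μ h - h ^ 2 / g =
                sSup ((fun h' : ℝ => q μ h' - h' ^ 2 / g) '' Set.Icc (-(13 * g + 1)) (13 * g + 1)) →
              h = hstar ∨ h = -hstar) →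
    TwSeededEnsembleEquivalenceR := fun hDiff hUniq =>
  twR_of_coldDifferentiablePressure
    (stub_coldAssembly stub_sourcedPressureLimit stub_danskinEnvelope
      (sourcedColdRegularity_of_freeFacts stub_sourcedPressureLimit
        (sourcedColdDiffUniq_of_diff_uniqSmall hDiff hUniq)
        stub_freePairEnergyBandBottom stub_freeDensityBandBottom stub_freeDensityNearHalfFilling))

end

end Summit.HubbardSuperconductivity.HubbardSuperconductivity.Theorems.TwSeededEnsembleEquivalenceR.ColdFloorLine
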